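import Summits.QuantumFields.YangMills.Theorems.AllWindowsColdBoxBoxHighLineEdgeTwoCentreSums
import Summits.QuantumFields.YangMills.Theorems.AllWindowsColdBoxBoxHighLineTripleBond

/-!
# Plaquette-indexed one- and two-centre lattice sums in the cold box (U5 prep, lifts L2/L3): the adapter of ✓`cubeShellSums` / ✓`cubeTwoCentreSums`
# to sums over `p ∈ plaquettesTouching (boxEdges 4 (2H+1))` (the index set of `cubicVertex` / `quarticWilson`)

Width seat `ym-line-sfw-p2-w3` (g41), cell ym-idea-1; helper-grade glue, companion of ✓`…EdgeTwoCentreSums`.  The L2 size lemmas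
(✓`WickPairCubic.abs_gaussAvg_centredLandauForm_mul_three_mul_three_le`, ✓`…centredLandauForms_mul_four_connected_le`) are summed by the U5 assembler over
the plaquettes `p'` of `V₃ = β·Σ_{p'} tripleForm` and of `W₄`; this file gives the corresponding counting lemmas:
* `plaq_base_sub_dirCorner_mem` — the shifted base site of a touching plaquette lies in `cubeSites (2H+2)` (✓`base_bounds_of_mem_plaquettesTouching`);
* ★ `sum_plaquettesTouching_le_mul_sum_cube` — `Σ_{p} f(p.1 − dirCorner) ≤ 16·Σ_{z ∈ cubeSites(2H+2)} f z` for `f ≥ 0`;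
* ★ `plaquetteShellSums'` — `Σ_p (1+d(p.1,x))⁻² ≤ C·H²`, `Σ_p (1+d(p.1,x))⁻⁴ ≤ C(1+log H)`, `Σ_p (1+d(p.1,x))⁻⁵ ≤ C`;
* ★ `plaquetteTwoCentreSums` — `Σ_p (1+d(p.1,x))⁻²(1+d(p.1,y))⁻² ≤ C(1+log H)`, `(2,4) ≤ C(1+log H)/(1+d(x,y))²`, `(4,4) ≤ C(1+log H)/(1+d(x,y))⁴`.

Everything proved, no definitions, standard axioms.  HONEST LABEL: counting glue for the RECORDED lifts L2/L3 of the NEXT rung U5 (⟨stmt-QuantumFields-24336⟩, UNSTAFFED);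
⟨24004⟩ ⟨24336⟩ remain OPEN; route AllWindowsColdBox is DRAFT; no crux, rung or summit is proved; **the Yang–Mills mass gap is NOT proved by this file; no summit is
proved by a line.**
-/

set_option autoImplicit false

noncomputable section

open Finset
open Literature.MathematicalPhysics.QuantumLattice (plaquettesTouching ZdPlaquette)
open Literature.MathematicalPhysics.QuantumFieldTheory.AxialGauge (boxEdges)
open Summit.QuantumFields.YangMills.Theorems.WeakCouplingRates
open Literature.Probability.LatticeModels (Site)

namespace Summit.QuantumFields.YangMills.Theorems.AllWindowsColdBoxBoxHighLine

namespace EdgeSums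

variable {H : ℕ}

/-- The shifted base site of a plaquette touching the box lies in `{0,…,2H+2}⁴`. -/
theorem plaq_base_sub_dirCorner_mem {p : ZdPlaquette 4} (hp : p ∈ plaquettesTouching (boxEdges 4 (2 * H + 1))) :
    p.1 - dirCorner ∈ cubeSites (2 * H + 2) := by
  simp only [cubeSites, Fintype.mem_piFinset, Finset.mem_Icc]
  intro k
  have h := base_bounds_of_mem_plaquettesTouching hp k
  simp only [Pi.sub_apply, dirCorner]
  constructor
  · omega
  · push_cast; omega

/-- ★ **Plaquette sums are at most sixteen cube sums**: `Σ_{p touching the box} f(p.1 − dirCorner) ≤ 16·Σ_{z ∈ cubeSites(2H+2)} f z` for `f ≥ 0`. -/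
theorem sum_plaquettesTouching_le_mul_sum_cube (f : Site 4 → ℝ) (hf : ∀ z, 0 ≤ f z) :
    ∑ p ∈ plaquettesTouching (boxEdges 4 (2 * H + 1)), f (p.1 - dirCorner) ≤ 16 * ∑ z ∈ cubeSites (2 * H + 2), f z := by
  classical
  set φ : ZdPlaquette 4 → Site 4 × {q : Fin 4 × Fin 4 // q.1 < q.2} := fun p => (p.1 - dirCorner, p.2) with hφ
  have hinj : Function.Injective φ := by
    intro p p' h
    simp only [hφ, Prod.mk.injEq, sub_left_inj] at h
    exact Prod.ext h.1 h.2
  have h1 : ∑ p ∈ plaquettesTouching (boxEdges 4 (2 * H + 1)), f (p.1 - dirCorner) =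
      ∑ z ∈ (plaquettesTouching (boxEdges 4 (2 * H + 1))).image φ, f z.1 := by
    rw [Finset.sum_image fun p _ p' _ h => hinj h]
  rw [h1]
  have hcard : (Fintype.card {q : Fin 4 × Fin 4 // q.1 < q.2} : ℝ) ≤ 16 := by
    have h := Fintype.card_subtype_le fun q : Fin 4 × Fin 4 => q.1 < q.2
    rw [Fintype.card_prod, Fintype.card_fin] at h
    exact_mod_cast h
  have hS0 : 0 ≤ ∑ z ∈ cubeSites (2 * H + 2), f z := Finset.sum_nonneg fun z _ => hf z
  calc ∑ z ∈ (plaquettesTouching (boxEdges 4 (2 * H + 1))).image φ, f z.1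
      ≤ ∑ z ∈ cubeSites (2 * H + 2) ×ˢ (Finset.univ : Finset {q : Fin 4 × Fin 4 // q.1 < q.2}), f z.1 :=
        Finset.sum_le_sum_of_subset_of_nonneg (fun z hz => by
          obtain ⟨p, hp, rfl⟩ := Finset.mem_image.1 hz
          exact Finset.mem_product.2 ⟨plaq_base_sub_dirCorner_mem hp, Finset.mem_univ _⟩) (fun z _ _ => hf z.1)
    _ = (Fintype.card {q : Fin 4 × Fin 4 // q.1 < q.2} : ℝ) * ∑ z ∈ cubeSites (2 * H + 2), f z := by
        rw [Finset.sum_product, Finset.mul_sum]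
        refine Finset.sum_congr rfl fun z _ => ?_
        simp only [Finset.sum_const, Finset.card_univ, nsmul_eq_mul]
    _ ≤ 16 * ∑ z ∈ cubeSites (2 * H + 2), f z := mul_le_mul_of_nonneg_right hcard hS0

/-- ★ **Plaquette shell sums**: `Σ_p (1+d(p.1,x))⁻² ≤ C·H²`, `Σ_p (1+d(p.1,x))⁻⁴ ≤ C(1+log H)`, `Σ_p (1+d(p.1,x))⁻⁵ ≤ C`. -/
theorem plaquetteShellSums' : ∃ C : ℝ, 0 ≤ C ∧ ∀ H : ℕ, 1 ≤ H → ∀ x : Site 4,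
    (∑ p ∈ plaquettesTouching (boxEdges 4 (2 * H + 1)), 1 / (1 + siteDist p.1 x) ^ 2 ≤ C * (H : ℝ) ^ 2) ∧
    (∑ p ∈ plaquettesTouching (boxEdges 4 (2 * H + 1)), 1 / (1 + siteDist p.1 x) ^ 4 ≤ C * (1 + Real.log H)) ∧
    (∑ p ∈ plaquettesTouching (boxEdges 4 (2 * H + 1)), 1 / (1 + siteDist p.1 x) ^ 5 ≤ C) := by
  obtain ⟨C₀, h₀⟩ := cubeShellSums
  have hC₀ : 0 ≤ C₀ := by
    have h := (h₀ 1 le_rfl 0).2.2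
    have hpos : 0 ≤ ∑ p ∈ cubeSites 1, 1 / (1 + siteDist p 0) ^ 5 :=
      Finset.sum_nonneg fun p _ => by have := GhostKernel.siteDist_nonneg p 0; positivity
    linarith
  refine ⟨256 * C₀, by positivity, fun H hH x => ?_⟩
  have hN : 1 ≤ 2 * H + 2 := by omega
  obtain ⟨h2, h4, h5⟩ := h₀ (2 * H + 2) hN (x - dirCorner)
  have hlog := one_add_log_cube_le hH
  have hH' : (1 : ℝ) ≤ H := by exact_mod_cast hH
  have hlogH : 0 ≤ Real.log H := Real.log_nonneg hH'
  have key : ∀ k : ℕ, ∑ p ∈ plaquettesTouching (boxEdges 4 (2 * H + 1)), 1 / (1 + siteDist p.1 x) ^ k ≤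
      16 * ∑ z ∈ cubeSites (2 * H + 2), 1 / (1 + siteDist z (x - dirCorner)) ^ k := by
    intro k
    have h := sum_plaquettesTouching_le_mul_sum_cube (H := H) (fun z => 1 / (1 + siteDist z (x - dirCorner)) ^ k)
      (fun z => by have := GhostKernel.siteDist_nonneg z (x - dirCorner); positivity)
    refine le_of_eq_of_le (Finset.sum_congr rfl fun p _ => ?_) h
    rw [siteDist_sub_sub]
  refine ⟨?_, ?_, ?_⟩
  · refine (key 2).trans ?_
    have hcast : ((2 * H + 2 : ℕ) : ℝ) ≤ 4 * H := by push_cast; linarith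
    calc 16 * ∑ z ∈ cubeSites (2 * H + 2), 1 / (1 + siteDist z (x - dirCorner)) ^ 2 ≤ 16 * (C₀ * ((2 * H + 2 : ℕ) : ℝ) ^ 2) :=
          mul_le_mul_of_nonneg_left h2 (by norm_num)
      _ ≤ 16 * (C₀ * (4 * H) ^ 2) := by gcongr
      _ = 256 * C₀ * (H : ℝ) ^ 2 := by ring
  · refine (key 4).trans ?_
    calc 16 * ∑ z ∈ cubeSites (2 * H + 2), 1 / (1 + siteDist z (x - dirCorner)) ^ 4
        ≤ 16 * (C₀ * (1 + Real.log (((2 * H + 2 : ℕ)) : ℝ))) := mul_le_mul_of_nonneg_left h4 (by norm_num)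
      _ ≤ 16 * (C₀ * (4 * (1 + Real.log H))) := by gcongr
      _ ≤ 256 * C₀ * (1 + Real.log H) := by nlinarith
  · refine (key 5).trans ?_
    calc 16 * ∑ z ∈ cubeSites (2 * H + 2), 1 / (1 + siteDist z (x - dirCorner)) ^ 5 ≤ 16 * C₀ :=
          mul_le_mul_of_nonneg_left h5 (by norm_num)
      _ ≤ 256 * C₀ := by nlinarith

/-- ★ **Plaquette two-centre sums**: uniformly in `x y ∈ ℤ⁴`, `H ≥ 1`,
`Σ_p (1+d(p.1,x))⁻²(1+d(p.1,y))⁻² ≤ C(1+log H)`, `Σ_p (1+d(p.1,x))⁻²(1+d(p.1,y))⁻⁴ ≤ C(1+log H)/(1+d(x,y))²`, `Σ_p (1+d(p.1,x))⁻⁴(1+d(p.1,y))⁻⁴ ≤ C(1+log H)/(1+d(x,y))⁴`. -/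
theorem plaquetteTwoCentreSums : ∃ C : ℝ, 0 ≤ C ∧ ∀ H : ℕ, 1 ≤ H → ∀ x y : Site 4,
    (∑ p ∈ plaquettesTouching (boxEdges 4 (2 * H + 1)), 1 / ((1 + siteDist p.1 x) ^ 2 * (1 + siteDist p.1 y) ^ 2) ≤ C * (1 + Real.log H)) ∧
    (∑ p ∈ plaquettesTouching (boxEdges 4 (2 * H + 1)), 1 / ((1 + siteDist p.1 x) ^ 2 * (1 + siteDist p.1 y) ^ 4) ≤
      C * (1 + Real.log H) / (1 + siteDist x y) ^ 2) ∧
    (∑ p ∈ plaquettesTouching (boxEdges 4 (2 * H + 1)), 1 / ((1 + siteDist p.1 x) ^ 4 * (1 + siteDist p.1 y) ^ 4) ≤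
      C * (1 + Real.log H) / (1 + siteDist x y) ^ 4) := by
  obtain ⟨C₀, h₀⟩ := cubeTwoCentreSums
  have hC₀ : 0 ≤ C₀ := by
    have h := (h₀ 1 le_rfl 0 0).1
    have hpos : 0 ≤ ∑ p ∈ cubeSites 1, 1 / ((1 + siteDist p 0) ^ 2 * (1 + siteDist p 0) ^ 2) :=
      Finset.sum_nonneg fun p _ => by have := GhostKernel.siteDist_nonneg p 0; positivity
    have : 0 ≤ C₀ * (1 + Real.log ((1 : ℕ) : ℝ)) := hpos.trans h
    simp at this; exact this
  refine ⟨64 * C₀, by positivity, fun H hH x y => ?_⟩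
  have hN : 1 ≤ 2 * H + 2 := by omega
  obtain ⟨h22, h24, h44⟩ := h₀ (2 * H + 2) hN (x - dirCorner) (y - dirCorner)
  rw [siteDist_sub_sub] at h24 h44
  have hlog := one_add_log_cube_le hH
  have hH' : (1 : ℝ) ≤ H := by exact_mod_cast hH
  have hlogH : 0 ≤ Real.log H := Real.log_nonneg hH'
  have hdxy := GhostKernel.siteDist_nonneg x y
  have key : ∀ k l : ℕ, ∑ p ∈ plaquettesTouching (boxEdges 4 (2 * H + 1)), 1 / ((1 + siteDist p.1 x) ^ k * (1 + siteDist p.1 y) ^ l) ≤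
      16 * ∑ z ∈ cubeSites (2 * H + 2), 1 / ((1 + siteDist z (x - dirCorner)) ^ k * (1 + siteDist z (y - dirCorner)) ^ l) := by
    intro k l
    have h := sum_plaquettesTouching_le_mul_sum_cube (H := H)
      (fun z => 1 / ((1 + siteDist z (x - dirCorner)) ^ k * (1 + siteDist z (y - dirCorner)) ^ l))
      (fun z => by
        have := GhostKernel.siteDist_nonneg z (x - dirCorner); have := GhostKernel.siteDist_nonneg z (y - dirCorner); positivity)
    refine le_of_eq_of_le (Finset.sum_congr rfl fun p _ => ?_) h
    rw [siteDist_sub_sub, siteDist_sub_sub]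
  have hlog' : C₀ * (1 + Real.log (((2 * H + 2 : ℕ)) : ℝ)) ≤ C₀ * (4 * (1 + Real.log H)) := mul_le_mul_of_nonneg_left hlog hC₀
  refine ⟨?_, ?_, ?_⟩
  · refine (key 2 2).trans ?_
    calc 16 * ∑ z ∈ cubeSites (2 * H + 2), 1 / ((1 + siteDist z (x - dirCorner)) ^ 2 * (1 + siteDist z (y - dirCorner)) ^ 2)
        ≤ 16 * (C₀ * (1 + Real.log (((2 * H + 2 : ℕ)) : ℝ))) := mul_le_mul_of_nonneg_left h22 (by norm_num)
      _ ≤ 16 * (C₀ * (4 * (1 + Real.log H))) := mul_le_mul_of_nonneg_left hlog' (by norm_num)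
      _ = 64 * C₀ * (1 + Real.log H) := by ring
  · refine (key 2 4).trans ?_
    calc 16 * ∑ z ∈ cubeSites (2 * H + 2), 1 / ((1 + siteDist z (x - dirCorner)) ^ 2 * (1 + siteDist z (y - dirCorner)) ^ 4)
        ≤ 16 * (C₀ * (1 + Real.log (((2 * H + 2 : ℕ)) : ℝ)) / (1 + siteDist x y) ^ 2) := mul_le_mul_of_nonneg_left h24 (by norm_num)
      _ ≤ 16 * (C₀ * (4 * (1 + Real.log H)) / (1 + siteDist x y) ^ 2) := by
          refine mul_le_mul_of_nonneg_left (div_le_div_of_nonneg_right hlog' (by positivity)) (by norm_num)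
      _ = 64 * C₀ * (1 + Real.log H) / (1 + siteDist x y) ^ 2 := by ring
  · refine (key 4 4).trans ?_
    calc 16 * ∑ z ∈ cubeSites (2 * H + 2), 1 / ((1 + siteDist z (x - dirCorner)) ^ 4 * (1 + siteDist z (y - dirCorner)) ^ 4)
        ≤ 16 * (C₀ * (1 + Real.log (((2 * H + 2 : ℕ)) : ℝ)) / (1 + siteDist x y) ^ 4) := mul_le_mul_of_nonneg_left h44 (by norm_num)
      _ ≤ 16 * (C₀ * (4 * (1 + Real.log H)) / (1 + siteDist x y) ^ 4) := by
          refine mul_le_mul_of_nonneg_left (div_le_div_of_nonneg_right hlog' (by positivity)) (by norm_num)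
      _ = 64 * C₀ * (1 + Real.log H) / (1 + siteDist x y) ^ 4 := by ring

end EdgeSums

end Summit.QuantumFields.YangMills.Theorems.AllWindowsColdBoxBoxHighLine

end
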